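import Literature.Probability.RandomPlanarGeometry.HydrodynamicMaps
import Literature.Probability.RandomPlanarGeometry.JoukowskiArcHulls
import HarnessLib

/-!
# The half-disc hull: `g(z) = z + R²/z`, `hcap = R²`, and Lawler's sharp bound `hcap(A) ≤ rad(A)²`

G. F. Lawler, *Conformally Invariant Processes in the Plane*, AMS (2005), §3.4: Example 3.38
("if `A = 𝔻̄ ∩ ℍ`, then `g_A(z) = z + 1/z`, `hcap(A) = 1`"), the scaling rule `hcap(rA) = r² hcap(A)`
and the monotonicity `hcap(A) ≤ hcap(B)` for hulls `A ⊆ B` ((3.8)/(3.10): `hcap(B) = hcap(A) +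
hcap(g_A(B ∖ A))` with `hcap ≥ 0`), which together give (3.9): **`hcap(A) ≤ rad(A)²`**,
`rad(A) = sup {|z| : z ∈ A}`.

The tree's `HydrodynamicMaps` develops the half-plane capacity `hcap K φ` of an abstract
hydrodynamically normalized conformal equivalence `φ : ℍ ∖ K → ℍ` (`IsHydrodynamicMap K φ`) and
proves additivity (`IsHydrodynamicMap.hcap_diffQuotient`) and nonnegativity (`hcap_nonneg`), but
only the bound `hcap ≤ 288 r²` for hulls in a disc of radius `r` (`hcap_le`). This proof-only
file (no definitions, no named facts) supplies the SHARP bound, needed for the capacity clock of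
[LSW] p. 13 (`s = hcap(J)/2 ≤ rad(J)²/2`, `LoewnerSlitFlow`):

* `Literature.Probability.RandomPlanarGeometry.bijOn_halfDisc` (and `mapsTo_…`, `injOn_…`,
  `surjOn_…`, `hasDerivAt_…`, `differentiableOn_invFunOn_halfDisc`) — the scaled Joukowski map
  `z ↦ R J(z/R) = z + R²/z` (the tree's `joukowski`, with its `ℍ`-branch inverse `joukowskiInv`)
  is a holomorphic bijection `ℍ ∖ B̄(0, R) → ℍ` with holomorphic inverse;
* `Literature.Probability.RandomPlanarGeometry.exists_isHydrodynamicMap_closedBall` — hence a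
  hydrodynamically normalized conformal equivalence `g : ℍ ∖ B̄(0, R) → ℍ`, `g(z) = z + R²/z`,
  with **`hcap = R²`** (`z (g(z) - z) ≡ R²`);
* `Literature.Probability.RandomPlanarGeometry.IsHydrodynamicMap.hcap_le_sq` — **Lawler's
  (3.9)**: if `K ∩ ℍ ⊆ B̄(0, R)` then `hcap K φ ≤ R²` for every hydrodynamically normalized
  `φ : ℍ ∖ K → ℍ` (monotonicity through the quotient map `g ∘ φ⁻¹`, `hcap_diffQuotient`,
  `hcap_nonneg`).

## References

* G. F. Lawler (2005), §3.4: Example 3.38, (3.8)–(3.10). [Lawler2005]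
-/

noncomputable section

open Set Filter Topology Metric Bornology Complex Function
open UpperHalfPlane (upperHalfPlaneSet isOpen_upperHalfPlaneSet)

namespace Literature.Probability.RandomPlanarGeometry

section HalfDisc

variable {R : ℝ}

/-! ### The scaled Joukowski map `z ↦ R J(z/R) = z + R²/z` -/

/-- `R J(z/R) = z + R²/z` (Lawler (2005), Example 3.38 with the scaling rule
`g_{rA}(z) = r g_A(z/r)`). [cite: Lawler2005, §3.4 Example 3.38] -/
theorem ofReal_mul_joukowski_div (hR : R ≠ 0) (z : ℂ) : (R : ℂ) * joukowski (z / R) = z + R ^ 2 / z := by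
  rw [joukowski_apply]
  have hR' : (R : ℂ) ≠ 0 := ofReal_ne_zero.2 hR
  by_cases hz : z = 0
  · subst hz; simp
  · field_simp

/-- `z/R ∈ ℍ` for `z ∈ ℍ`, `R > 0`. [folklore] -/
theorem div_ofReal_mem_upperHalfPlaneSet (hR : 0 < R) {z : ℂ} (hz : z ∈ upperHalfPlaneSet) :
    z / (R : ℂ) ∈ upperHalfPlaneSet := by
  show 0 < (z / (R : ℂ)).im
  rw [div_ofReal_im]
  exact div_pos hz hR

/-- Membership in `ℍ ∖ B̄(0, R)`. [folklore] -/
theorem mem_upperHalfPlaneSet_diff_closedBall_iff {z : ℂ} :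
    z ∈ upperHalfPlaneSet \ closedBall (0 : ℂ) R ↔ z ∈ upperHalfPlaneSet ∧ R < ‖z‖ := by
  rw [Set.mem_sdiff, mem_closedBall, dist_zero_right, not_le]

/-- `z ↦ R J(z/R)` maps `ℍ ∖ B̄(0, R)` into `ℍ` (`Im J(w) > 0` for `w ∈ ℍ`, `|w| > 1`). [cite: Lawler2005, §3.4 Example 3.38] -/
theorem mapsTo_halfDisc (hR : 0 < R) :
    MapsTo (fun z : ℂ ↦ (R : ℂ) * joukowski (z / R)) (upperHalfPlaneSet \ closedBall (0 : ℂ) R)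
      upperHalfPlaneSet := by
  intro z hz
  rw [mem_upperHalfPlaneSet_diff_closedBall_iff] at hz
  have hzR : z / (R : ℂ) ∈ upperHalfPlaneSet := div_ofReal_mem_upperHalfPlaneSet hR hz.1
  have h1 : 1 < ‖z / (R : ℂ)‖ := by
    rw [norm_div, norm_real, Real.norm_of_nonneg hR.le, one_lt_div hR]
    exact hz.2
  have h2 : 0 < (joukowski (z / R)).im := (joukowski_im_pos_iff hzR).2 h1
  show 0 < ((R : ℂ) * joukowski (z / R)).im
  rw [im_ofReal_mul]
  exact mul_pos hR h2

/-- `z ↦ R J(z/R)` is injective on `ℍ ∖ B̄(0, R)` (`J` is injective on `ℍ`). [cite: Lawler2005, §3.4 Example 3.38] -/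
theorem injOn_halfDisc (hR : 0 < R) :
    InjOn (fun z : ℂ ↦ (R : ℂ) * joukowski (z / R)) (upperHalfPlaneSet \ closedBall (0 : ℂ) R) := by
  intro z₁ hz₁ z₂ hz₂ h
  have hR' : (R : ℂ) ≠ 0 := ofReal_ne_zero.2 hR.ne'
  have h' : joukowski (z₁ / R) = joukowski (z₂ / R) := mul_left_cancel₀ hR' h
  have h₁ := div_ofReal_mem_upperHalfPlaneSet hR hz₁.1
  have h₂ := div_ofReal_mem_upperHalfPlaneSet hR hz₂.1
  have heq := injOn_joukowski_upperHalfPlaneSet h₁ h₂ h'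
  have := congrArg (fun w : ℂ ↦ w * R) heq
  simpa only [div_mul_cancel₀ _ hR'] using this

/-- `z ↦ R J(z/R)` maps `ℍ ∖ B̄(0, R)` onto `ℍ`: `w = R J(J⁻¹(w/R))` with `R J⁻¹(w/R) ∈ ℍ`,
`|R J⁻¹(w/R)| > R`. [cite: Lawler2005, §3.4 Example 3.38] -/
theorem surjOn_halfDisc (hR : 0 < R) :
    SurjOn (fun z : ℂ ↦ (R : ℂ) * joukowski (z / R)) (upperHalfPlaneSet \ closedBall (0 : ℂ) R)
      upperHalfPlaneSet := by
  intro w hw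
  have hR' : (R : ℂ) ≠ 0 := ofReal_ne_zero.2 hR.ne'
  have hwR : w / (R : ℂ) ∈ upperHalfPlaneSet := div_ofReal_mem_upperHalfPlaneSet hR hw
  have hwR' : 0 < (w / (R : ℂ)).im := hwR
  have hws : w / (R : ℂ) ∈ slitCompl (-2) 2 := Or.inl hwR'.ne'
  set ζ : ℂ := joukowskiInv (w / R) with hζdef
  have hζ : ζ ∈ upperHalfPlaneSet := joukowskiInv_mem hws
  have hζ' : 0 < ζ.im := hζ
  have hζ1 : 1 < ‖ζ‖ := (one_lt_norm_joukowskiInv_iff hws).2 hwR'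
  refine ⟨R * ζ, ⟨?_, ?_⟩, ?_⟩
  · show 0 < ((R : ℂ) * ζ).im
    rw [im_ofReal_mul]
    exact mul_pos hR hζ'
  · rw [mem_closedBall, dist_zero_right, norm_mul, norm_real, Real.norm_of_nonneg hR.le, not_le]
    nlinarith
  · show (R : ℂ) * joukowski ((R : ℂ) * ζ / R) = w
    rw [mul_div_cancel_left₀ ζ hR', hζdef, joukowski_joukowskiInv hws, mul_div_cancel₀ _ hR']

/-- **`z ↦ R J(z/R) = z + R²/z` is a bijection `ℍ ∖ B̄(0, R) → ℍ`.** [cite: Lawler2005, §3.4 Example 3.38] -/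
theorem bijOn_halfDisc (hR : 0 < R) :
    BijOn (fun z : ℂ ↦ (R : ℂ) * joukowski (z / R)) (upperHalfPlaneSet \ closedBall (0 : ℂ) R)
      upperHalfPlaneSet :=
  ⟨mapsTo_halfDisc hR, injOn_halfDisc hR, surjOn_halfDisc hR⟩

/-- The derivative of `z ↦ R J(z/R)` at a point of `ℍ` is `J'(z/R)`. [folklore] -/
theorem hasDerivAt_halfDisc (hR : 0 < R) {z : ℂ} (hz : z ∈ upperHalfPlaneSet) :
    HasDerivAt (fun z : ℂ ↦ (R : ℂ) * joukowski (z / R)) (deriv joukowski (z / R)) z := by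
  have hR' : (R : ℂ) ≠ 0 := ofReal_ne_zero.2 hR.ne'
  have hzR := div_ofReal_mem_upperHalfPlaneSet hR hz
  have h1 := hasDerivAt_joukowski (UpperHalfPlane.ne_zero ⟨_, hzR⟩)
  have h2 : HasDerivAt (fun y : ℂ ↦ y / R) (1 / R : ℂ) z := (hasDerivAt_id z).div_const (R : ℂ)
  have h3 := (h1.comp z h2).const_mul (R : ℂ)
  have h4 : HasDerivAt (fun z : ℂ ↦ (R : ℂ) * joukowski (z / R))
      ((R : ℂ) * ((1 - ((z / R) ^ 2)⁻¹) * (1 / R))) z := h3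
  rw [h1.deriv]
  refine h4.congr_deriv ?_
  field_simp

/-- `z ↦ R J(z/R)` is holomorphic on `ℍ ∖ B̄(0, R)`. [folklore] -/
theorem differentiableOn_halfDisc (hR : 0 < R) :
    DifferentiableOn ℂ (fun z : ℂ ↦ (R : ℂ) * joukowski (z / R))
      (upperHalfPlaneSet \ closedBall (0 : ℂ) R) :=
  fun _ hz ↦ (hasDerivAt_halfDisc hR hz.1).differentiableAt.differentiableWithinAt

/-- `ℍ ∖ B̄(0, R)` is open. [folklore] -/
theorem isOpen_upperHalfPlaneSet_diff_closedBall (R : ℝ) :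
    IsOpen (upperHalfPlaneSet \ closedBall (0 : ℂ) R) :=
  isOpen_upperHalfPlaneSet.sdiff isClosed_closedBall

/-- The inverse of `z ↦ R J(z/R)` on `ℍ` is holomorphic (holomorphic inverse function theorem,
`J' ≠ 0` on `ℍ`). [folklore] -/
theorem differentiableOn_invFunOn_halfDisc (hR : 0 < R) :
    DifferentiableOn ℂ (invFunOn (fun z : ℂ ↦ (R : ℂ) * joukowski (z / R))
      (upperHalfPlaneSet \ closedBall (0 : ℂ) R)) upperHalfPlaneSet := by
  have h := Complex.differentiableOn_invFunOn_image (isOpen_upperHalfPlaneSet_diff_closedBall R)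
    (differentiableOn_halfDisc hR) (injOn_halfDisc hR) (fun z hz ↦ by
      rw [(hasDerivAt_halfDisc hR hz.1).deriv]
      exact deriv_joukowski_ne_zero_of_mem (div_ofReal_mem_upperHalfPlaneSet hR hz.1))
  rwa [(bijOn_halfDisc hR).image_eq] at h

/-- `B̄(0, R) ∩ ℍ` is bounded. [folklore] -/
theorem isBounded_closedBall_inter_upperHalfPlaneSet (R : ℝ) :
    IsBounded (closedBall (0 : ℂ) R ∩ upperHalfPlaneSet) :=
  isBounded_closedBall.subset inter_subset_left

/-- **The half-disc hull `B̄(0, R) ∩ ℍ̄` has a hydrodynamically normalized map `g(z) = z + R²/z`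
with `hcap = R²`** (Lawler (2005), Example 3.38: `g_{𝔻̄ ∩ ℍ}(z) = z + 1/z`, `hcap = 1`, scaled;
`g(z) - z = R²/z → 0` and `z (g(z) - z) ≡ R²`). [cite: Lawler2005, §3.4 Example 3.38] -/
theorem exists_isHydrodynamicMap_closedBall (hR : 0 < R) :
    ∃ g : ConformalEquiv (upperHalfPlaneSet \ closedBall (0 : ℂ) R) upperHalfPlaneSet,
      IsHydrodynamicMap (closedBall (0 : ℂ) R) g ∧ hcap (closedBall (0 : ℂ) R) g = R ^ 2 ∧
        ∀ z, g z = z + R ^ 2 / z := by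
  set g : ConformalEquiv (upperHalfPlaneSet \ closedBall (0 : ℂ) R) upperHalfPlaneSet :=
    ConformalEquiv.ofBijOn (fun z : ℂ ↦ (R : ℂ) * joukowski (z / R)) (differentiableOn_halfDisc hR)
      (bijOn_halfDisc hR) (differentiableOn_invFunOn_halfDisc hR) with hg
  have happ : ∀ z, g z = z + R ^ 2 / z := fun z ↦ by
    rw [hg, ConformalEquiv.ofBijOn_apply, ofReal_mul_joukowski_div hR.ne']
  have hH : IsHydrodynamicMap (closedBall (0 : ℂ) R) g := by
    unfold IsHydrodynamicMap
    have h1 : Tendsto (fun z : ℂ ↦ z⁻¹) (cocompact ℂ) (𝓝 0) := by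
      rw [← cobounded_eq_cocompact]
      exact tendsto_inv₀_cobounded
    have h2 : Tendsto (fun z : ℂ ↦ ((R : ℂ) ^ 2) * z⁻¹) (cocompact ℂ) (𝓝 0) := by
      simpa using h1.const_mul ((R : ℂ) ^ 2)
    refine (h2.mono_left inf_le_left).congr' (Eventually.of_forall fun z ↦ ?_)
    show (R : ℂ) ^ 2 * z⁻¹ = g z - z
    rw [happ]
    ring
  refine ⟨g, hH, ?_, happ⟩
  have hb := isBounded_closedBall_inter_upperHalfPlaneSet R
  haveI := IsHydrodynamicMap.neBot_cocompact_inf hb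
  have h1 := hH.tendsto_mul_sub_self hb
  have h2 : Tendsto (fun z : ℂ ↦ z * (g z - z))
      (cocompact ℂ ⊓ 𝓟 (upperHalfPlaneSet \ closedBall (0 : ℂ) R)) (𝓝 (((R ^ 2 : ℝ) : ℂ))) := by
    refine (tendsto_const_nhds (x := (((R ^ 2 : ℝ) : ℂ)))).congr' ?_
    filter_upwards [mem_inf_of_right (mem_principal_self _)] with z hz
    have hz0 : z ≠ 0 := UpperHalfPlane.ne_zero ⟨_, hz.1⟩
    rw [happ]
    push_cast
    field_simp
    ring
  exact_mod_cast tendsto_nhds_unique h1 h2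

end HalfDisc

/-! ### Lawler's (3.9): `hcap(A) ≤ rad(A)²` -/

namespace IsHydrodynamicMap

variable {K : Set ℂ} {φ : ConformalEquiv (upperHalfPlaneSet \ K) upperHalfPlaneSet} {R : ℝ}

/-- **`hcap(A) ≤ rad(A)²`** (Lawler (2005), (3.9)): if `K ∩ ℍ ⊆ B̄(0, R)`, `R > 0`, then
`hcap K φ ≤ R²` for every hydrodynamically normalized `φ : ℍ ∖ K → ℍ` — by the additivity
`hcap(g ∘ φ⁻¹) = hcap(g) - hcap(φ)` for the half-disc map `g` (`hcap(g) = R²`) and `hcap ≥ 0`.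
[cite: Lawler2005, §3.4 (3.9)] -/
theorem hcap_le_sq (hφ : IsHydrodynamicMap K φ) (hR : 0 < R)
    (hK : K ∩ upperHalfPlaneSet ⊆ closedBall (0 : ℂ) R) : hcap K φ ≤ R ^ 2 := by
  obtain ⟨g, h₂, hcapg, -⟩ := exists_isHydrodynamicMap_closedBall hR
  have h12 : upperHalfPlaneSet \ closedBall (0 : ℂ) R ⊆ upperHalfPlaneSet \ K :=
    fun z hz ↦ ⟨hz.1, fun hzK ↦ hz.2 (hK ⟨hzK, hz.1⟩)⟩
  have hbK : IsBounded (K ∩ upperHalfPlaneSet) := isBounded_closedBall.subset hK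
  have hbB := isBounded_closedBall_inter_upperHalfPlaneSet R
  have hQ := hφ.diffQuotient h₂ hbK h12
  have hbQ := hφ.isBounded_diffImage hbK hbB (K₂ := closedBall (0 : ℂ) R)
  have hnn := hQ.hcap_nonneg hbQ
  rw [hφ.hcap_diffQuotient h₂ hbK hbB h12, hcapg] at hnn
  linarith

/-- **`hcap(A) ≤ rad(A)²`, pointwise form**: if every point of `K` has norm `≤ R` (`R > 0`) then
`hcap K φ ≤ R²`. [cite: Lawler2005, §3.4 (3.9)] -/
theorem hcap_le_sq_of_norm_le (hφ : IsHydrodynamicMap K φ) (hR : 0 < R)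
    (hK : ∀ z ∈ K, ‖z‖ ≤ R) : hcap K φ ≤ R ^ 2 :=
  hφ.hcap_le_sq hR fun z hz ↦ by
    rw [mem_closedBall, dist_zero_right]
    exact hK z hz.1

end IsHydrodynamicMap

end Literature.Probability.RandomPlanarGeometry

end
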